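import Summits.NavierStokesRegularity.FluidComputer.RowSwitchEq
import HarnessLib

/-!
# `RowSwitch`: the decidable certificate check of a STAGE hand-over `r | r'` (new lock coordinate
# `p' ≠ p`) in the Taylor/bootstrap form (`pub-fluidc-bp3/R1-DESIGN.md` §8.8 (3) + gen-21 addendum §8.11)

HONEST FRAMING (cell `pub-fluidc`, blueprint seat bp3, gens 21–22): low prior, high value-of-information
experiment on Tao's machine paradigm; NOT a claim that NS blows up. Bookkeeping only — this file is the
BOOLEAN (kernel twin of `code/thgate/g21/kgen21.py rebox_switch_v4 --swsub 16`); its soundness is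
`RowSwitchSound` (the transfer) + `RowSwitchWindow` (the window lemma), whose extra hypotheses are
listed below; `SwWin` / `swStageOK_win` is what the window lemma reads off the Boolean.

The member is re-timed at the switch instant: `σ ↦ σ'` with `y_{p'}(σ') = X0_{p'}`, `X0 = x̂'(t_sw)` the
new row's reference point. With `d(ξ) := y(ξ) − X0 = e + (ξ − σ) F0 + I(ξ)`, `I(ξ) := ∫_σ^ξ (ẏ − F0)`,
`F0 := F(X0)`, `J0 := J(X0)` and the field homogeneous quadratic (`ChainField.taylor_split_mat`), exactly
`ẏ − F0 = J0 d + F(d) + δF`, `e_new = d(σ') = P' e + P' I(σ')`, `P' = I − F0 e_{p'}ᵀ / F0_{p'}`,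
`σ' − σ = −(e_{p'} + I_{p'}(σ')) / F0_{p'}`. The certificate `SwCert` = window half-width `Ds`, window box
`wid` and a sub-stepped majorant table `b` (16 sub-windows, `b 0 = 0`, `B := b 16` bounds `|I|` on the
window); `swStageOK` checks, in the kernel's `P`-scaled integers and outward-rounded intervals:
(B_j) `b_{j+1} > b_j + h (|J0| (Ē + s_{j+1} |F0| + b_{j+1}) + Fabs(wid) + DELw)`, `h = Ds/16`;
(M) `0 ≤ b_0`, `b_j ≤ b_{j+1}` (the majorant table is monotone: the continuity argument starts each
sub-window from the previous bound and uses `b_{j+1} ≤ B` in (W); without (M) a table with negative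
entries could pass (B_j) vacuously — found when proving the window lemma, gen 22);
(W) `Ē + Ds |F0| + B < wid` ((B_j), (W) STRICT: the room a closed-condition continuity argument needs —
no `ε`); (D) `Ds |F0_{p'}|_lo ≥ Ē_{p'} + B_{p'} + 2^{-P}`;
(U) `|F0_{p'}|_lo > (|J0| wid)_{p'} + Fabs(wid)_{p'} + DELw_{p'}` (no second root in the window); and the
RESULT `Σ_j |(A'P'T̂₁)_{ij}| u_j + Σ_k |(A'P'(I − T̂₁Â₁))_{ik}| Ē_k + Σ_a |(A'P')_{ia}| B_a + 2^{-P} ≤ u'_i`,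
`DELw := max (DEL r) (DEL r')`. Hypotheses the soundness theorem will need beyond `MemberOn` of both rows:
the window `|ξ − σ| ≤ Ds` lies in the member's domain, `|δF| ≤ DELw` there, and the new row's phase map
picks THE root in the window (`|s'(t_sw) − s(t_sw)| ≤ Ds`). Equal-phase switches: `RowSwitchEq`.

[cite: Tao2016AveragedNS, §5.5 Thm 5.3 (5.5)]
-/

namespace Summit.NavierStokesRegularity.FluidComputer

open Literature.Analysis.FluidPDE.FluidComputer
open Literature.Analysis.ValidatedNumerics.Numerics (cdiv)

namespace RowCheck

open DIVec ChainField

/-- Certificate of a stage hand-over (all `P`-scaled integers of the rows' `P`): window half-width `Ds`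
(member-parameter units), window box `wid` (state units) and the sub-stepped majorant table `b`
(`b j a` bounds `|I_a|` on the first `j` sixteenths of the window; `b 0 = 0`). [folklore] -/
structure SwCert where
  /-- window half-width `Ds · 2^P` -/
  Ds : ℤ
  /-- window box half-widths `wid · 2^P` -/
  wid : Fin 9 → ℤ
  /-- majorant table `b j a · 2^P`, `j = 0 … 16` -/
  b : Fin 17 → Fin 9 → ℤ

namespace RowData

variable (r r' : RowData) (c : SwCert)

/-- The new row's reference point `X0 = x̂'(t_sw) = c₀` as point/width-one intervals (`CI[·][0]`). [folklore] -/
def X0I (a : Fin 9) : DI := (r'.CI a).headD (DI.pt 0)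

/-- `F0 = F(X0)` (interval). [folklore] -/
def F0I (a : Fin 9) : DI := FI r'.P r'.cU r'.cD r'.X0I a

/-- `J0 = J(X0)` (interval). [folklore] -/
def J0I (a b : Fin 9) : DI := JmatI r'.P r'.cU r'.cD r'.X0I a b

/-- `|F0_{p'}|_lo` for a sign-definite `F0_{p'}` (else junk; `swWinOn` checks `signDef`). [folklore] -/
def PhiLo : ℤ := if (r'.F0I r'.p).posB then (r'.F0I r'.p).lo else -(r'.F0I r'.p).hi

/-- The re-timing projector `P' = I − F0 e_{p'}ᵀ / F0_{p'}` (interval; `P'_{p'p'} = 0` exactly). [folklore] -/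
def PnI : Fin 9 → Fin 9 → DI := (r'.PT (Vec.mk' r'.F0I) (r'.sInv (r'.F0I r'.p))).at

/-- `A'P'` (interval). [folklore] -/
def APn : Fin 9 → Fin 9 → DI := DIVec.mul r'.P r'.A0I r'.PnI

/-- `I − T̂₁Â₁` of the OLD row (interval). [folklore] -/
def RoI : Fin 9 → Fin 9 → DI := DIVec.subM (eyeI r.P) (DIVec.mul r.P r.T1I r.A1I)

/-- **Window checks** (B_j), (M), (W), (D), (U) of the module docstring on the NEW row's tables, given the
old row's end state box `Eb`, the window defect class `DELw` and `St = Eb p'`. [folklore] -/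
def swWinOn (Eb DELw : Fin 9 → ℤ) (St : ℤ) : Bool :=
  let ONE : ℤ := 2 ^ r'.P
  let aF : Fin 9 → ℤ := fun a => (r'.F0I a).mag
  let aJ : Fin 9 → Fin 9 → ℤ := fun a b => (r'.J0I a b).mag
  let FQ : Fin 9 → ℤ := FabsB r'.P r'.cU r'.cD c.wid
  let h : ℤ := cdiv c.Ds 16
  let B : Fin 9 → ℤ := c.b (Fin.last 16)
  decide (0 ≤ c.Ds) && signDef (r'.F0I r'.p) && decide (∀ a, 0 ≤ c.b 0 a) &&
  decide (∀ j : Fin 16, ∀ a, c.b j.castSucc a ≤ c.b j.succ a) &&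
  decide (∀ j : Fin 16, ∀ a,
    c.b j.castSucc a + cdiv (h * ((∑ bb, cdiv (aJ a bb *
      (Eb bb + cdiv (h * ((j : ℕ) + 1 : ℤ) * aF bb) ONE + c.b j.succ bb)) ONE) + FQ a + DELw a)) ONE <
    c.b j.succ a) &&
  decide (∀ a, Eb a + cdiv (c.Ds * aF a) ONE + B a < c.wid a) &&
  decide ((St + B r'.p + 1) * ONE ≤ c.Ds * r'.PhiLo) &&
  decide ((∑ bb, cdiv (aJ r'.p bb * c.wid bb) ONE) + FQ r'.p + DELw r'.p < r'.PhiLo)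

/-- **The stage hand-over check** given the old row's certified end slot box `un`: same scale, a genuine
stage switch, the reference point continued exactly (`x̂'(0) = x̂(H)`), the window checks, and the RESULT
inequality of the module docstring against the new row's start box `u'`. [folklore] -/
def swStageOn (un : Vec ℤ 8) : Bool :=
  let ONE : ℤ := 2 ^ r'.P
  let L1 : Fin 9 → Fin 9 → DI := DIVec.mul r'.P r'.APn r.T1I
  let L2 : Fin 9 → Fin 9 → DI := DIVec.mul r'.P r'.APn r.RoI
  let B : Fin 9 → ℤ := c.b (Fin.last 16)
  decide (r'.P = r.P) && decide (r'.p ≠ r.p) &&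
  decide (∀ a : Fin 9, evalQ (r'.CQ a) 0 = evalQ (r.CQ a) r.Hq) &&
  r'.swWinOn c r.Eb (fun a => max (r.DEL a) (r'.DEL a)) (r.Eb r'.p) &&
  decide (∀ i : Fin 8,
    (∑ j : Fin 8, cdiv ((L1 i.succ j.succ).mag * un.get j) ONE) +
      (∑ k, cdiv ((L2 i.succ k).mag * r.Eb k) ONE) + (∑ a, cdiv ((r'.APn i.succ a).mag * B a) ONE) + 1 ≤
    r'.u i.succ)

/-- **`swStageOK r r' c`**: the stage hand-over `r | r'` with certificate `c` passes (old end box = the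
certified `uNext` of `r.rowCheck`). [folklore] -/
def swStageOK : Bool := swStageOn r r' c r.rowCheck.uNext

variable {r r' c} in
/-- What the soundness theorem reads off `swStageOK`: the common scale, the continued reference point,
the sign-definite `F0_{p'}`, and the RESULT inequality. [folklore] -/
theorem swStageOK_parts (hs : swStageOK r r' c = true) :
    r'.P = r.P ∧ (∀ a : Fin 9, evalQ (r'.CQ a) 0 = evalQ (r.CQ a) r.Hq) ∧
    signDef (r'.F0I r'.p) = true ∧
    ∀ i : Fin 8, (∑ j : Fin 8, cdiv ((DIVec.mul r'.P r'.APn r.T1I i.succ j.succ).mag *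
        r.rowCheck.uNext.get j) (2 ^ r'.P)) +
      (∑ k, cdiv ((DIVec.mul r'.P r'.APn r.RoI i.succ k).mag * r.Eb k) (2 ^ r'.P)) +
      (∑ a, cdiv ((r'.APn i.succ a).mag * c.b (Fin.last 16) a) (2 ^ r'.P)) + 1 ≤ r'.u i.succ := by
  simp only [swStageOK, swStageOn, Bool.and_eq_true, decide_eq_true_eq] at hs
  obtain ⟨⟨⟨⟨hP, -⟩, hx⟩, hw⟩, hres⟩ := hs
  simp only [swWinOn, Bool.and_eq_true, decide_eq_true_eq] at hw
  exact ⟨hP, hx, hw.1.1.1.1.1.1.2, hres⟩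

/-- **The window facts a passing stage hand-over check carries** (read by `RowSwitchWindow`): the
window half-width is nonnegative, `F0_{p'}` is sign-definite, the majorant table starts nonnegative and
is monotone (M), the sixteen strict sub-window inequalities (B_j), the strict window box (W), the root
bracket (D) and the no-second-root inequality (U) — all in the rows' `P`-scaled integers (a
proof-carrying record, deliberately `Type`-valued like `MemberOn` / `GateOK`). [folklore] -/
structure SwWin : Type where
  /-- same scale -/
  hP : r'.P = r.P
  /-- a genuine stage switch -/
  hp : r'.p ≠ r.p
  /-- `0 ≤ Ds` -/
  hDs : 0 ≤ c.Ds
  /-- `F0_{p'}` sign-definite -/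
  hsd : signDef (r'.F0I r'.p) = true
  /-- `0 ≤ b 0` -/
  hb0 : ∀ a, 0 ≤ c.b 0 a
  /-- (M) -/
  hmono : ∀ j : Fin 16, ∀ a, c.b j.castSucc a ≤ c.b j.succ a
  /-- (B_j) -/
  hB : ∀ j : Fin 16, ∀ a,
    c.b j.castSucc a + cdiv (cdiv c.Ds 16 * ((∑ bb, cdiv ((r'.J0I a bb).mag *
      (r.Eb bb + cdiv (cdiv c.Ds 16 * ((j : ℕ) + 1 : ℤ) * (r'.F0I bb).mag) (2 ^ r'.P) + c.b j.succ bb))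
        (2 ^ r'.P)) + FabsB r'.P r'.cU r'.cD c.wid a + max (r.DEL a) (r'.DEL a))) (2 ^ r'.P) <
    c.b j.succ a
  /-- (W) -/
  hW : ∀ a, r.Eb a + cdiv (c.Ds * (r'.F0I a).mag) (2 ^ r'.P) + c.b (Fin.last 16) a < c.wid a
  /-- (D) -/
  hD : (r.Eb r'.p + c.b (Fin.last 16) r'.p + 1) * 2 ^ r'.P ≤ c.Ds * r'.PhiLo
  /-- (U) -/
  hU : (∑ bb, cdiv ((r'.J0I r'.p bb).mag * c.wid bb) (2 ^ r'.P)) + FabsB r'.P r'.cU r'.cD c.wid r'.p +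
    max (r.DEL r'.p) (r'.DEL r'.p) < r'.PhiLo

variable {r r' c} in
/-- `swStageOK` carries the window facts. [folklore] -/
def swStageOK_win (hs : swStageOK r r' c = true) : SwWin r r' c := by
  simp only [swStageOK, swStageOn, Bool.and_eq_true, decide_eq_true_eq] at hs
  obtain ⟨⟨⟨⟨hP, hp⟩, -⟩, hw⟩, -⟩ := hs
  simp only [swWinOn, Bool.and_eq_true, decide_eq_true_eq] at hw
  obtain ⟨⟨⟨⟨⟨⟨⟨hDs, hsd⟩, hb0⟩, hmono⟩, hB⟩, hW⟩, hD⟩, hU⟩ := hw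
  exact ⟨hP, hp, hDs, hsd, hb0, hmono, hB, hW, hD, hU⟩

end RowData

end RowCheck

end Summit.NavierStokesRegularity.FluidComputer
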